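import Mathlib
import Literature.ModelTheory.ExponentialFields.SemialgebraicPreparation
import Literature.NumberTheory.Transcendental.SemialgebraicMapsProofs
import HarnessLib

/-!
# Solo-informed (A390-ii): simultaneous Lion–Rolin preparation as a cover

File F3a of the KERNEL LEMMA I programme (integrability loci of `ℚ`-semialgebraic families are
`ℚ`-semialgebraic, via the vendored preparation fact
`Literature.ModelTheory.ExponentialFields.semialgebraicPreparation`).

The preparation fact prepares ONE function on the bands of ONE decomposition.  The log-room
theorem needs a finite family `f₀, …, f_N` prepared SIMULTANEOUSLY on common bands.  We obtain
this by iterated refinement, keeping only what the measure-theoretic arguments downstream use: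

* `soloInformed_stackCover` — over a base point, every height lies on a section or in a band
  (no monotonicity of the sections is needed);
* `soloInformed_isSemialgebraic_bandOver` — bands over `ℚ`-semialgebraic data are
  `ℚ`-semialgebraic (light-import re-proof of `isSemialgebraic_bandOver'`);
* `soloInformed_isLRPreparedOn_monoBase` — prepared forms restrict to smaller
  `ℚ`-semialgebraic bases and smaller bands;
* `SoloInformedPreparedCover A f` — a finite family of bands `bandOver (B κ) (ξ κ) (j κ) ⊆ A`
  over `ℚ`-semialgebraic bases with `ℚ`-semialgebraic sections, on each of which EVERY `f i` is
  prepared, together with finitely many graphs of `ℚ`-semialgebraic functions, covering `A`;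
* `soloInformed_preparedCover` — assuming `semialgebraicPreparation`, every finite family of
  `ℚ`-semialgebraic functions on a `ℚ`-semialgebraic `A ⊆ ℝⁿ⁺¹` admits such a cover
  (induction on the size of the family: prepare the last function on each band of the cover
  obtained for the others and intersect the bases).

No disjointness is recorded: downstream only subadditivity over the cover and monotonicity
along `band ⊆ A` are used.
-/

open Set
open Literature.ModelTheory.ExponentialFields Literature.NumberTheory.Transcendental

namespace Summit.KontsevichZagierPeriods.KontsevichZagierPeriods.Theorems

/-! ### Cover of a cylinder by the cells of a stack -/

/-- Over a base point `w`, every height `y` either lies on one of the sections `ξ i w` or strictly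
between two consecutive boundary values of the stack (the band just below the least section
`≥ y`, or the top band).  No monotonicity of the sections is required. -/
theorem soloInformed_stackCover {n l : ℕ} (ξ : Fin l → (Fin n → ℝ) → ℝ) (w : Fin n → ℝ)
    (y : ℝ) :
    (∃ i : Fin l, y = ξ i w) ∨
      ∃ j : Fin (l + 1), bandLower ξ j w < (y : EReal) ∧ (y : EReal) < bandUpper ξ j w := by
  classical
  by_cases h : ∃ i : Fin l, y ≤ ξ i w
  · have hspec : y ≤ ξ (Fin.find _ h) w := Fin.find_spec h
    have hmin : ∀ i : Fin l, i < Fin.find _ h → ξ i w < y := fun i hi =>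
      not_le.mp (Fin.find_min h hi)
    rcases hspec.eq_or_lt with heq | hlt
    · exact Or.inl ⟨_, heq⟩
    · refine Or.inr ⟨(Fin.find _ h).castSucc, ?_, ?_⟩
      · by_cases h0 : (Fin.find _ h).castSucc = 0
        · rw [h0, bandLower_zero]
          exact EReal.bot_lt_coe y
        · rw [bandLower_of_ne_zero ξ _ h0, EReal.coe_lt_coe_iff]
          apply hmin
          rw [Fin.lt_def, Fin.val_pred, Fin.val_castSucc]
          have h0' : ((Fin.find _ h).castSucc : ℕ) ≠ 0 := fun h' =>
            h0 (Fin.ext (by rw [h']; rfl))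
          rw [Fin.val_castSucc] at h0'
          omega
      · rw [bandUpper_castSucc, EReal.coe_lt_coe_iff]
        exact hlt
  · push Not at h
    refine Or.inr ⟨Fin.last l, ?_, ?_⟩
    · by_cases h0 : Fin.last l = 0
      · rw [h0, bandLower_zero]
        exact EReal.bot_lt_coe y
      · rw [bandLower_of_ne_zero ξ _ h0, EReal.coe_lt_coe_iff]
        exact h _
    · rw [bandUpper_last]
      exact EReal.coe_lt_top y

/-- Membership form of `soloInformed_stackCover`: a point of the cylinder over `S` lies on a
graph cell or in a band cell of the stack. -/
theorem soloInformed_snoc_mem_stackCell {n l : ℕ} (S : Set (Fin n → ℝ))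
    (ξ : Fin l → (Fin n → ℝ) → ℝ) {w : Fin n → ℝ} (hw : w ∈ S) (y : ℝ) :
    (∃ i : Fin l, (Fin.snoc w y : Fin (n + 1) → ℝ) ∈ graphOver S (ξ i)) ∨
      ∃ j : Fin (l + 1), (Fin.snoc w y : Fin (n + 1) → ℝ) ∈ bandOver S ξ j := by
  rcases soloInformed_stackCover ξ w y with ⟨i, hi⟩ | ⟨j, hj₁, hj₂⟩
  · exact Or.inl ⟨i, snoc_mem_graphOver_iff.mpr ⟨hw, hi⟩⟩
  · exact Or.inr ⟨j, snoc_mem_bandOver_iff.mpr ⟨hw, hj₁, hj₂⟩⟩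

/-- A point of a band over `S`, whose base point lies in `S'`, lies in the band over `S'`. -/
theorem soloInformed_mem_bandOver_of_init_mem {n l : ℕ} {S S' : Set (Fin n → ℝ)}
    {ξ : Fin l → (Fin n → ℝ) → ℝ} {j : Fin (l + 1)} {z : Fin (n + 1) → ℝ}
    (hz : z ∈ bandOver S ξ j) (hz' : Fin.init z ∈ S') : z ∈ bandOver S' ξ j :=
  ⟨hz', hz.2⟩

/-- Bands over a `ℚ`-semialgebraic base cut out by `ℚ`-semialgebraic sections are `ℚ`-semialgebraic
(the `k = ℚ` instance of `isSemialgebraic_bandOver'` of `SemialgebraicDimension.lean`, re-proved here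
from `isSemialgebraic_setOf_le/ge` to keep the import closure of this file small). -/
theorem soloInformed_isSemialgebraic_bandOver {n l : ℕ} {S : Set (Fin n → ℝ)}
    {ξ : Fin l → (Fin n → ℝ) → ℝ} (hS : IsSemialgebraic ℚ S)
    (hξ : ∀ i, IsSemialgebraicFunOn ℚ S (ξ i)) (j : Fin (l + 1)) :
    IsSemialgebraic ℚ (bandOver S ξ j) := by
  have hV : IsSemialgebraic ℚ {z : Fin (n + 1) → ℝ | Fin.init z ∈ S} := hS.setOf_init_mem
  have hlow : IsSemialgebraic ℚ {z : Fin (n + 1) → ℝ | Fin.init z ∈ S ∧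
      bandLower ξ j (Fin.init z) < (z (Fin.last n) : EReal)} := by
    by_cases h0 : j = 0
    · subst h0
      convert hV using 1
      ext z
      simp
    · have h := (hξ (j.pred h0)).isSemialgebraic_setOf_le tarski_seidenberg_real_holds
      convert hV.diff h using 1
      ext z
      simp only [mem_setOf_eq, Set.mem_sdiff, bandLower_of_ne_zero ξ j h0, EReal.coe_lt_coe_iff,
        not_and, not_le]
      exact ⟨fun ⟨hz, hlt⟩ => ⟨hz, fun _ => hlt⟩, fun ⟨hz, h'⟩ => ⟨hz, h' hz⟩⟩
  have hup : IsSemialgebraic ℚ {z : Fin (n + 1) → ℝ | Fin.init z ∈ S ∧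
      (z (Fin.last n) : EReal) < bandUpper ξ j (Fin.init z)} := by
    by_cases hl : j = Fin.last l
    · subst hl
      convert hV using 1
      ext z
      simp
    · have h := (hξ (j.castPred hl)).isSemialgebraic_setOf_ge tarski_seidenberg_real_holds
      convert hV.diff h using 1
      ext z
      simp only [mem_setOf_eq, Set.mem_sdiff, bandUpper_of_ne_last ξ j hl, EReal.coe_lt_coe_iff,
        not_and, not_le]
      exact ⟨fun ⟨hz, hlt⟩ => ⟨hz, fun _ => hlt⟩, fun ⟨hz, h'⟩ => ⟨hz, h' hz⟩⟩
  have hset : bandOver S ξ j = {z : Fin (n + 1) → ℝ | Fin.init z ∈ S ∧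
      bandLower ξ j (Fin.init z) < (z (Fin.last n) : EReal)} ∩
      {z | Fin.init z ∈ S ∧ (z (Fin.last n) : EReal) < bandUpper ξ j (Fin.init z)} := by
    ext z
    simp only [mem_bandOver_iff, mem_inter_iff, mem_setOf_eq]
    tauto
  rw [hset]
  exact hlow.inter hup

/-! ### Restriction of prepared forms to smaller bases -/

/-- A Lion–Rolin prepared form restricts to a smaller `ℚ`-semialgebraic base and a smaller band
(same exponent, unit and coefficient data). -/
theorem soloInformed_isLRPreparedOn_monoBase {n : ℕ} {S S' : Set (Fin n → ℝ)}
    {T T' : Set (Fin (n + 1) → ℝ)} {f : (Fin (n + 1) → ℝ) → ℝ} (h : IsLRPreparedOn S T f)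
    (hS : S' ⊆ S) (hS' : IsSemialgebraic ℚ S') (hT : T' ⊆ T) : IsLRPreparedOn S' T' f := by
  obtain ⟨r, q, M, c, δ, a, θ, b, b₁, b₂, v, hq, hc, hδ, ha, hθ, hb, hb₁, hb₂, hne, hvsa, hvan, hvc,
    hcube, hf⟩ := h
  exact ⟨r, q, M, c, δ, a, θ, b, b₁, b₂, v, hq, hc, hδ, ha.mono hS hS', hθ.mono hS hS',
    fun i => (hb i).mono hS hS', hb₁.mono hS hS', hb₂.mono hS hS', fun z hz => hne z (hT hz),
    hvsa, hvan, hvc, fun z hz => hcube z (hT hz), fun z hz => hf z (hT hz)⟩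

/-! ### Prepared covers -/

/-- **Prepared cover** of `A ⊆ ℝⁿ⁺¹` for the family `f`: finitely many bands
`bandOver (B κ) (ξ κ) (j κ) ⊆ A` over `ℚ`-semialgebraic bases `B κ` with `ℚ`-semialgebraic sections
`ξ κ i`, on each of which every `f i` is Lion–Rolin prepared over `B κ`, and finitely many graphs
of `ℚ`-semialgebraic functions `η κ'` over `ℚ`-semialgebraic bases `B' κ'`, such that the bands and
graphs together cover `A`.  (The graphs need not lie in `A`; no disjointness is recorded.) -/
def SoloInformedPreparedCover {n N : ℕ} (A : Set (Fin (n + 1) → ℝ))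
    (f : Fin N → (Fin (n + 1) → ℝ) → ℝ) : Prop :=
  ∃ (ι : Type) (_ : Finite ι) (B : ι → Set (Fin n → ℝ)) (l : ι → ℕ)
    (ξ : (κ : ι) → Fin (l κ) → (Fin n → ℝ) → ℝ) (j : (κ : ι) → Fin (l κ + 1))
    (ι' : Type) (_ : Finite ι') (B' : ι' → Set (Fin n → ℝ)) (η : ι' → (Fin n → ℝ) → ℝ),
    (∀ κ, IsSemialgebraic ℚ (B κ)) ∧ (∀ κ i, IsSemialgebraicFunOn ℚ (B κ) (ξ κ i)) ∧
    (∀ κ, bandOver (B κ) (ξ κ) (j κ) ⊆ A) ∧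
    (∀ κ', IsSemialgebraic ℚ (B' κ')) ∧ (∀ κ', IsSemialgebraicFunOn ℚ (B' κ') (η κ')) ∧
    (A ⊆ (⋃ κ, bandOver (B κ) (ξ κ) (j κ)) ∪ ⋃ κ', graphOver (B' κ') (η κ')) ∧
    ∀ κ i, IsLRPreparedOn (B κ) (bandOver (B κ) (ξ κ) (j κ)) (f i)

/-- One preparation step: assuming `semialgebraicPreparation`, a single `ℚ`-semialgebraic
function on a `ℚ`-semialgebraic `A` has a prepared cover (the bands and graphs of the preparing
stack that meet `A`). -/
theorem soloInformed_preparedCover_one (hprep : semialgebraicPreparation) {n : ℕ}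
    {A : Set (Fin (n + 1) → ℝ)} (hA : IsSemialgebraic ℚ A) {g : (Fin (n + 1) → ℝ) → ℝ}
    (hg : IsSemialgebraicFunOn ℚ A g) : SoloInformedPreparedCover A (fun _ : Fin 1 => g) := by
  classical
  obtain ⟨𝒮, l, ξ, h𝒮, -, hsa, -, hgr, hband, hprepared⟩ := hprep n A g hA hg
  have hSsa : ∀ S ∈ 𝒮, IsSemialgebraic ℚ S := h𝒮.isSemialgebraic
  -- band index: cells `S ∈ 𝒮` and band numbers `j` with `bandOver S (ξ S) j ⊆ A`
  refine ⟨(Σ S : ↥𝒮, {j : Fin (l S + 1) // bandOver (S : Set (Fin n → ℝ)) (ξ S) j ⊆ A}),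
    inferInstance, fun κ => κ.1, fun κ => l κ.1, fun κ => ξ κ.1, fun κ => κ.2.1,
    (Σ S : ↥𝒮, Fin (l S)), inferInstance, fun κ' => κ'.1, fun κ' => ξ κ'.1 κ'.2,
    fun κ => hSsa _ κ.1.2, fun κ i => hsa _ κ.1.2 i, fun κ => κ.2.2, fun κ' => hSsa _ κ'.1.2,
    fun κ' => hsa _ κ'.1.2 κ'.2, ?_, ?_⟩
  · intro z hz
    obtain ⟨S, ⟨hS, hwS⟩, -⟩ := h𝒮.isPartition.2 (Fin.init z)
    have hzw : z = Fin.snoc (Fin.init z) (z (Fin.last n)) := (Fin.snoc_init_self z).symm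
    rcases soloInformed_snoc_mem_stackCell S (ξ S) hwS (z (Fin.last n)) with ⟨i, hi⟩ | ⟨j, hj⟩
    · refine Or.inr (mem_iUnion.mpr ⟨⟨⟨S, hS⟩, i⟩, ?_⟩)
      rw [hzw]
      exact hi
    · rw [← hzw] at hj
      have hsub : bandOver S (ξ S) j ⊆ A :=
        (hband S hS j).resolve_right fun hdis => hdis.le_bot ⟨hj, hz⟩
      exact Or.inl (mem_iUnion.mpr ⟨⟨⟨S, hS⟩, ⟨j, hsub⟩⟩, hj⟩)
  · intro κ i
    exact hprepared _ κ.1.2 _ κ.2.2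

/-- Refinement step: from a prepared cover for `f₀, …, f_N` to one for `f₀, …, f_N, g`, by preparing
`g` on each band of the given cover and intersecting the new bases with the old ones. -/
theorem soloInformed_preparedCover_snoc (hprep : semialgebraicPreparation) {n N : ℕ}
    {A : Set (Fin (n + 1) → ℝ)} {f : Fin N → (Fin (n + 1) → ℝ) → ℝ}
    (hcov : SoloInformedPreparedCover A f) {g : (Fin (n + 1) → ℝ) → ℝ}
    (hg : IsSemialgebraicFunOn ℚ A g) :
    SoloInformedPreparedCover A (Fin.snoc f g : Fin (N + 1) → (Fin (n + 1) → ℝ) → ℝ) := by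
  classical
  obtain ⟨ι, hι, B, l, ξ, j, ι', hι', B', η, hB, hξ, hBA, hB', hη, hAcov, hfprep⟩ := hcov
  -- the old bands
  set D : ι → Set (Fin (n + 1) → ℝ) := fun κ => bandOver (B κ) (ξ κ) (j κ) with hD
  have hDsa : ∀ κ, IsSemialgebraic ℚ (D κ) := fun κ =>
    soloInformed_isSemialgebraic_bandOver (hB κ) (hξ κ) (j κ)
  have hgD : ∀ κ, IsSemialgebraicFunOn ℚ (D κ) g := fun κ => hg.mono (hBA κ) (hDsa κ)
  -- prepare `g` on each old band
  choose 𝒮 lS ξS h𝒮 _hcont hsa _hmono hgr hband hprepared using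
    fun κ => hprep n (D κ) g (hDsa κ) (hgD κ)
  have hSsa : ∀ κ, ∀ S ∈ 𝒮 κ, IsSemialgebraic ℚ S := fun κ => (h𝒮 κ).isSemialgebraic
  refine ⟨(Σ κ : ι, Σ S : ↥(𝒮 κ),
      {j' : Fin (lS κ S + 1) // bandOver (S : Set (Fin n → ℝ)) (ξS κ S) j' ⊆ D κ}),
    inferInstance, fun μ => (μ.2.1 : Set (Fin n → ℝ)) ∩ B μ.1, fun μ => lS μ.1 μ.2.1,
    fun μ => ξS μ.1 μ.2.1, fun μ => μ.2.2.1,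
    ι' ⊕ (Σ κ : ι, Σ S : ↥(𝒮 κ), Fin (lS κ S)), inferInstance,
    Sum.elim B' fun ν => (ν.2.1 : Set (Fin n → ℝ)), Sum.elim η fun ν => ξS ν.1 ν.2.1 ν.2.2,
    fun μ => (hSsa _ _ μ.2.1.2).inter (hB μ.1),
    fun μ i => (hsa _ _ μ.2.1.2 i).mono inter_subset_left ((hSsa _ _ μ.2.1.2).inter (hB μ.1)),
    fun μ => (Set.Subset.trans
      (show bandOver ((μ.2.1 : Set (Fin n → ℝ)) ∩ B μ.1) (ξS μ.1 μ.2.1) μ.2.2.1 ⊆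
          bandOver (μ.2.1 : Set (Fin n → ℝ)) (ξS μ.1 μ.2.1) μ.2.2.1 from
        fun _ hz => ⟨inter_subset_left hz.1, hz.2⟩) μ.2.2.2).trans (hBA μ.1),
    ?_, ?_, ?_, ?_⟩
  · rintro (κ' | ν)
    · exact hB' κ'
    · exact hSsa _ _ ν.2.1.2
  · rintro (κ' | ν)
    · exact hη κ'
    · exact hsa _ _ ν.2.1.2 ν.2.2
  · intro z hz
    rcases hAcov hz with hzb | hzg
    · obtain ⟨κ, hzκ⟩ := mem_iUnion.mp hzb
      have hwB : Fin.init z ∈ B κ := hzκ.1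
      obtain ⟨S, ⟨hS, hwS⟩, -⟩ := (h𝒮 κ).isPartition.2 (Fin.init z)
      have hzw : z = Fin.snoc (Fin.init z) (z (Fin.last n)) := (Fin.snoc_init_self z).symm
      rcases soloInformed_snoc_mem_stackCell S (ξS κ S) hwS (z (Fin.last n)) with
        ⟨i, hi⟩ | ⟨j', hj'⟩
      · refine Or.inr (mem_iUnion.mpr ⟨Sum.inr ⟨κ, ⟨S, hS⟩, i⟩, ?_⟩)
        rw [hzw]
        exact hi
      · rw [← hzw] at hj'
        have hsub : bandOver S (ξS κ S) j' ⊆ D κ :=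
          (hband κ S hS j').resolve_right fun hdis => hdis.le_bot ⟨hj', hzκ⟩
        refine Or.inl (mem_iUnion.mpr ⟨⟨κ, ⟨S, hS⟩, ⟨j', hsub⟩⟩, ?_⟩)
        exact soloInformed_mem_bandOver_of_init_mem hj' ⟨hwS, hwB⟩
    · obtain ⟨κ', hzκ'⟩ := mem_iUnion.mp hzg
      exact Or.inr (mem_iUnion.mpr ⟨Sum.inl κ', hzκ'⟩)
  · rintro ⟨κ, ⟨S, hS⟩, ⟨j', hsub⟩⟩ i
    have hS'sa : IsSemialgebraic ℚ ((S : Set (Fin n → ℝ)) ∩ B κ) := (hSsa _ _ hS).inter (hB κ)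
    have hTsub : bandOver ((S : Set (Fin n → ℝ)) ∩ B κ) (ξS κ S) j' ⊆ bandOver S (ξS κ S) j' :=
      fun _ hz => ⟨inter_subset_left hz.1, hz.2⟩
    refine Fin.lastCases ?_ (fun i₀ => ?_) i
    · rw [Fin.snoc_last]
      exact soloInformed_isLRPreparedOn_monoBase (hprepared κ S hS j' hsub) inter_subset_left
        hS'sa hTsub
    · rw [Fin.snoc_castSucc]
      exact soloInformed_isLRPreparedOn_monoBase (hfprep κ i₀) inter_subset_right hS'sa
        (hTsub.trans hsub)

/-- **Simultaneous preparation** (assuming `semialgebraicPreparation`): every finite family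
`f₀, …, f_N` (`N + 1 ≥ 1` functions) of `ℚ`-semialgebraic functions on a `ℚ`-semialgebraic
`A ⊆ ℝⁿ⁺¹` admits a prepared cover. -/
theorem soloInformed_preparedCover (hprep : semialgebraicPreparation) {n : ℕ} (N : ℕ)
    {A : Set (Fin (n + 1) → ℝ)} (hA : IsSemialgebraic ℚ A)
    (f : Fin (N + 1) → (Fin (n + 1) → ℝ) → ℝ) (hf : ∀ i, IsSemialgebraicFunOn ℚ A (f i)) :
    SoloInformedPreparedCover A f := by
  induction N with
  | zero =>
    have hfe : f = fun _ : Fin 1 => f 0 := funext fun i => by rw [Fin.fin_one_eq_zero i]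
    rw [hfe]
    exact soloInformed_preparedCover_one hprep hA (hf 0)
  | succ N ih =>
    have hfe : f = Fin.snoc (fun i => f (Fin.castSucc i)) (f (Fin.last (N + 1))) :=
      (Fin.snoc_init_self f).symm
    rw [hfe]
    exact soloInformed_preparedCover_snoc hprep (ih _ fun i => hf _) (hf _)

end Summit.KontsevichZagierPeriods.KontsevichZagierPeriods.Theorems
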